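import Summits.QuantumFields.YangMills.Theorems.UnitScaleTiltProp7CombTowerLevelUnitarity
import HarnessLib

/-!
# Route `UnitScaleTilt`, crux K1 «MinimiserStabilityRegPr» (stmt-QuantumFields-19200), route-R E′ (A′)-on-Σ, P-A2 (β) — **(c3)ᶜ hP-FREE, FILE 2∕2:
# PRINT's COMB TOWER `\overline{U₁U₀}ʲ, U̿₁ʲ, v_j, Ũ₁ʲ` IS UNITARY-VALUED AND WITHIN `O(Lʲb)` OF `1` FOR A SKEW, SUP-SMALL PERTURBATION — WITHOUT (1.141); THE T³ MEMBER**

Cell `ym3-torus` (HUMAN RULING D-0037: YM₃ on the torus is ladder rung R3 — not d = 4, not a mass gap, not Clay), width seat `ym3-torus-px17` (gen 4); ★★OWNER RULING №19 «F3″-COMB (c1)(c2)(c4)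
under `hMcomb`» (pen ★routeR-w6 g8: F1 ✓`Prop7CombAccFrameStep`, F2, F3) — the (c3) SUP∕UNITARITY input of that plan, typed so that F1's `hv hv' hhol`, F2's walk-sum letters, px13 g6's R0-DOOR
`hcU` and routeR-w1 g9's (O2) groundwork cite THEOREMS instead of lit rows whose (1.141) window the (β) door cannot supply (FILE 1's header: the located point).
`--supports stmt-QuantumFields-19200 --as helper`; THEOREMS ONLY (0 `def`, 0 `sorry`); count-neutral.  Nothing of `hMcomb`, (β), `hPA2`, `hcoS`, E′, EX, the crux, d = 4 or the gap is claimed.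

THE PRINT.  [Balaban1985Averaging] (42)–(43) pp. 23–24, (52)–(54) p. 26, (69) p. 29, (82) p. 30, (89)–(92) p. 31, (97) p. 32, (159)–(163) p. 42, p. 44; [Balaban1985RegularSpaces] Prop. 7
(1.139)–(1.145) p. 100; [Balaban1985Variational] (2) p. 278, (19) p. 281, (44) p. 285.

WHAT IS PROVED (ns `…Theorems.Prop7CombTowerUnitaryOfSkew`).
* §1 (the tower, `ℤᵈ`, lit letters; hypotheses = lit `B8Prop7AdmittedFamily` §3's MINUS `hBu hαP hαP3 hαP2 hP`, PLUS `hBs : star (B z κ) = −B z κ` and `hsm2 : 4096·d(d+1)·Lᵏb ≤ 1`):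
  ★★★**`comb_tower_mem_unitaryUnits`**`: ∀ j ≤ k, (∀ z κ, avgIter L (e^{B}·U₀) j z κ ∈ U(𝔸)) ∧ (∀ z κ, U̿₁ʲ(z,κ) ∈ U(𝔸)) ∧ (∀ z, v_j(z) ∈ U(𝔸))` — ONE joint induction: frame step = lit
  ✓`wframe_mem_unitaryUnits` ∘ ✓`twist_le_quarter`; plain-average step = lit ✓`bavg_mem_unitaryUnits` through FILE 1's ✓`Wcx_window_of_mem` (replacing lit's (1.141)); double-bar step = lit's (89)∘(93)
  algebra verbatim.  Corollaries ★★`tildIter_mem_unitaryUnits`, ★★`norm_tildIter_sub_one_le_of_skew` (`130dLʲb`), `norm_dbavgCovIter_sub_one_le_of_skew` (`2Lʲb`), `norm_vcov_le_one_of_skew` (F1's `hv hv'`),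
  `wframe_mem_unitaryUnits_of_skew`, ★`tHol_tildIter_mem_and_norm_sub_one_le` (the single-bar tree ratios of F2's walk sums: unitary, within `(1+130dLʲb)^{|Γ|} − 1`).
* §2 (T³ member, `SU(2)`, the (β) door's letters): `star_I_smul_eq_neg` (`A := I•D`, `D` Hermitian, is skew); ★★★`comb_tower_mem_unitaryUnits_of_regPr` — for `RegPr F n K ε₀ W`, `A` bondwise skew with
  `‖A b‖ ≤ e·η`, (WΣ) (✓`norm_frameTw_sub_one_le_of_regPr`'s windows VERBATIM) + `10⁶L²e ≤ 1`: at every `l ≤ K − n` the tower of `hMcomb`'s own objects (`W♯ = pull (bgUnits W) basePt`,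
  `(e^{A})♯ = pull (fun b ↦ expUnit (A b)) basePt`) is `U(2)`-valued and `‖Ũ₁ˡ − 1‖ ≤ 390·Lˡ·e·η`; ★★`frameTw_mem_unitaryUnits_of_regPr` (`frameTw W A y ∈ U(2)`, `‖·‖ ≤ 1`, `‖·⁻¹‖ ≤ 1` = px13's `hcU`).
HONEST SCOPE.  One induction + bookkeeping over lit's certified identities and FILE 1; constants are this lineage's; no `ℓ²` statement, nothing of (n3)-comb.

References: T. Bałaban, CMP **98** (1985) 17–51 [Balaban1985Averaging]; CMP **99** (1985) 75–102 [Balaban1985RegularSpaces]; CMP **102** (1985) 277–309 [Balaban1985Variational];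
CMP **109** (1987) 249–301 [Balaban1987RG1] ((0.4) p.253).
-/

set_option autoImplicit false

noncomputable section

open scoped BigOperators Matrix.Norms.L2Operator

namespace Summit.QuantumFields.YangMills.Theorems.Prop7CombTowerUnitaryOfSkew

open NormedSpace
open Literature.MathematicalPhysics.QuantumFieldTheory.Balaban1983to89
open B7Prop1Explicit renaming Site → LSite
open B7Prop1Explicit (Letter hol hol_cons hol_nil hol_append stepHol e disp gammaWord seg treeWord boxVec l1 l1_boxVec_le length_gammaWord length_seg Wcx Wcx_eq_hol_loop U1 mem_U1
  expUnit val_expUnit plaqWord norm_inv_sub_one_le norm_units_conj_sub_one_le bavg)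
open B7Prop2Explicit (avgIter avgIter_zero avgIter_succ rescale pdev le_pdev C0 c2' unitaryUnits mem_unitaryUnits unitaryUnits_le_U1 avgClosed_unitaryUnits bavg_mem_unitaryUnits
  norm_Wcx_sub_one_le hol_mem_of)
open B7Prop3Flat (expCfg c3)
open B7Eq92Concrete (Rc Rc_apply mgauge mgauge_apply tHol wframe tild tild_apply dbavgCov dbavgCov_apply tildIter tildIter_mul tildIter_eq_mgauge dbavgCovIter dbavgCovIter_zero
  dbavgCovIter_succ vcov vcov_zero vcov_succ)
open B7Eq162General (level_facts)
open B7Eq123General (level_data)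
open B7Prop8PrintedConstants (norm_exp_sub_one_le_of_mem_unitary Rc_mem_unitaryUnits)
open B8Prop7AdmittedFamily (wframe_mem_unitaryUnits tild_eq_of_mgauge avgIter_mem_unitaryUnits twist_le_quarter norm_vcov_sub_one_le)
open B8Lemma1NonAbelian (norm_units_mul_sub_one_le)
open Summit.QuantumFields.YangMills.Theorems.Prop7CombTowerLevelUnitarity

variable {d : ℕ}

/-! ## §1 The whole tower: one joint induction on the level -/

section Tower

variable {𝔸 : Type*} [CStarAlgebra 𝔸] [Nontrivial 𝔸]

open B7Prop4GeneralLevels (logCovIter)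

variable {L k : ℕ} {U₀ : LSite d → Fin d → 𝔸ˣ} {B : LSite d → Fin d → 𝔸} {α₀ b : ℝ}
  (hd : 1 ≤ d) (hL : 2 ≤ L) (hU₀ : ∀ x κ, U₀ x κ ∈ unitaryUnits 𝔸) (hBs : ∀ x κ, star (B x κ) = -B x κ)
  (hα : 0 < α₀) (hα3 : C0 d * α₀ ≤ 1 / 3) (hα4 : 4 * α₀ ≤ c2' d L) (h52 : pdev U₀ < α₀ * (((L : ℝ) ^ k)⁻¹) ^ 2)
  (hb : 0 ≤ b) (hB : ∀ x κ, ‖B x κ‖ ≤ b)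
  (hsmall : Real.exp (4 * (800 * ((d : ℝ) + 1) ^ 2 * ((d : ℝ) + 4)) * α₀)
    * (1 + 8 * (131072 * ((d : ℝ) + 1) ^ 2) * ((L : ℝ) ^ k * b)) ≤ 2)
  (hc₃ : 2 * ((L : ℝ) ^ k * b) ≤ c3 d L)
  (hsm2 : 4096 * (d : ℝ) * ((d : ℝ) + 1) * ((L : ℝ) ^ k * b) ≤ 1)

include hd hL hU₀ hBs hα hα3 hα4 h52 hb hB hsmall hc₃ hsm2 in
/-- ★★★ **THE COMB TOWER OF A SKEW, SUP-SMALL PERTURBATION IS UNITARY-VALUED AT EVERY LEVEL `j ≤ k` — WITHOUT (1.141)**: the plain averages `\overline{U₁U₀}ʲ` (43), the double-bar averages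
`U̿₁ʲ` (90)∕(91) and the accumulated frames `v_j` (97) of `U₁ = e^{B}` (`B` bondwise skew-adjoint, `‖B‖ ≤ b`, `4096·d(d+1)·Lᵏb ≤ 1`) at a regular background `U₀` ((52), the Prop.-2∕Prop.-4
windows) take values in the unitary group of `𝔸`.  ONE joint induction on `j`: the frame step is lit ✓`wframe_mem_unitaryUnits` ∘ ✓`twist_le_quarter`; the PLAIN-AVERAGE step is lit
✓`bavg_mem_unitaryUnits` on `Ũ₁ʲ·Ū₀ʲ` through the `¼`-window `Wcx_window_of_mem` (this replaces lit's use of (1.141) via `avgIter_mem`); the double-bar step is lit's (89)∘(93) algebra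
(`tild_eq_of_mgauge` at `v_j`, `Ũ₁ʲ = (U̿₁ʲ)^{v_j}`) verbatim. [cite: Balaban1985Averaging, (42)-(43) pp.23-24, (89)-(92) p.31, (97) p.32, (22)-(24) p.21, p.44; Balaban1985RegularSpaces, Prop. 7 (1.139)-(1.145) p.100] -/
theorem comb_tower_mem_unitaryUnits :
    ∀ j ≤ k, (∀ (z : LSite d) (κ : Fin d), avgIter L (expCfg B * U₀) j z κ ∈ unitaryUnits 𝔸) ∧
      (∀ (z : LSite d) (κ : Fin d), dbavgCovIter L U₀ (expCfg B) j z κ ∈ unitaryUnits 𝔸) ∧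
      ∀ z : LSite d, vcov L U₀ (expCfg B) j z ∈ unitaryUnits 𝔸 := by
  have hsm := (level_windows hd hL hb hsm2).1
  have hBu : ∀ x κ, expCfg B x κ ∈ unitaryUnits 𝔸 := expCfg_mem_unitaryUnits_of_skew hBs
  intro j
  induction j with
  | zero =>
    intro _
    refine ⟨fun z κ => ?_, fun z κ => by rw [dbavgCovIter_zero]; exact hBu z κ, fun z => by rw [vcov_zero]; exact (unitaryUnits 𝔸).one_mem⟩
    rw [avgIter_zero, Pi.mul_apply, Pi.mul_apply]
    exact (unitaryUnits 𝔸).mul_mem (hBu z κ) (hU₀ z κ)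
  | succ j ih =>
    intro hj1
    have hjk : j < k := Nat.lt_of_succ_le hj1
    obtain ⟨hA, hW, hv⟩ := ih hjk.le
    have hV₀ := avgIter_mem_unitaryUnits hL hU₀ hα hα3 hα4 h52 j hjk.le
    have hfr : ∀ y : LSite d, wframe L (avgIter L U₀ j) (dbavgCovIter L U₀ (expCfg B) j) y ∈ unitaryUnits 𝔸 := fun y =>
      wframe_mem_unitaryUnits L hV₀ hW y (fun r => twist_le_quarter hd hL hU₀ hα hα3 hα4 h52 hb hB hsmall hc₃ hsm hjk y r)
    -- the plain average `\overline{U₁U₀}^{j+1} = \overline{(Ũ₁ʲŪ₀ʲ)}` is unitary: its block loops are in the `¼`-window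
    have hA1 : ∀ (z : LSite d) (κ : Fin d), avgIter L (expCfg B * U₀) (j + 1) z κ ∈ unitaryUnits 𝔸 := by
      intro z κ
      rw [avgIter_succ]
      show bavg L (avgIter L (expCfg B * U₀) j) ((L : ℤ) • z) κ ∈ unitaryUnits 𝔸
      exact bavg_mem_unitaryUnits hA L _ κ (fun r => Wcx_window_of_mem hd hL hU₀ hα hα3 hα4 h52 hb hB hsmall hc₃ hsm2 hjk hW hv _ κ r)
    refine ⟨hA1, fun z κ => ?_, fun z => ?_⟩
    · -- `U̿₁^{j+1}(c)` read on the `(j+1)`-st lattice — lit's (89)∘(93) algebra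
      have h1 : avgIter L (expCfg B * U₀) (j + 1) z κ ∈ unitaryUnits 𝔸 := hA1 z κ
      have h2 : avgIter L U₀ (j + 1) z κ ∈ unitaryUnits 𝔸 := avgIter_mem_unitaryUnits hL hU₀ hα hα3 hα4 h52 (j + 1) hj1 z κ
      have htild : tild L (avgIter L U₀ j) (tildIter L U₀ (expCfg B) j) ((L : ℤ) • z) κ ∈ unitaryUnits 𝔸 := by
        rw [tild_apply, tildIter_mul]
        exact (unitaryUnits 𝔸).mul_mem h1 ((unitaryUnits 𝔸).inv_mem h2)
      have hbavg : bavg L (avgIter L U₀ j) ((L : ℤ) • z) κ ∈ unitaryUnits 𝔸 := h2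
      rw [dbavgCovIter_succ, dbavgCov_apply,
        tild_eq_of_mgauge L (avgIter L U₀ j) (dbavgCovIter L U₀ (expCfg B) j) (vcov L U₀ (expCfg B) j), ← tildIter_eq_mgauge L U₀ (expCfg B) j]
      refine (unitaryUnits 𝔸).mul_mem ((unitaryUnits 𝔸).mul_mem ((unitaryUnits 𝔸).inv_mem (hfr _)) ?_) (Rc_mem_unitaryUnits hbavg (hfr _))
      exact (unitaryUnits 𝔸).mul_mem ((unitaryUnits 𝔸).mul_mem ((unitaryUnits 𝔸).inv_mem (hv _)) htild) (Rc_mem_unitaryUnits hbavg (hv _))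
    · rw [vcov_succ]
      exact (unitaryUnits 𝔸).mul_mem (hv _) (hfr _)

include hd hL hU₀ hBs hα hα3 hα4 h52 hb hB hsmall hc₃ hsm2 in
/-- ★★ **`Ũ₁ʲ` (69) IS UNITARY-VALUED, every `j ≤ k`** (hP-free). [cite: Balaban1985Averaging, (69) p.29, (92) p.31, (97) p.32] -/
theorem tildIter_mem_unitaryUnits {j : ℕ} (hj : j ≤ k) (z : LSite d) (κ : Fin d) : tildIter L U₀ (expCfg B) j z κ ∈ unitaryUnits 𝔸 := by
  obtain ⟨-, hW, hv⟩ := comb_tower_mem_unitaryUnits hd hL hU₀ hBs hα hα3 hα4 h52 hb hB hsmall hc₃ hsm2 j hj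
  exact tildIter_mem_unitaryUnits_of_mem hL hU₀ hα hα3 hα4 h52 hj hW hv z κ

include hd hL hU₀ hBs hα hα3 hα4 h52 hb hB hsmall hc₃ hsm2 in
/-- ★★ **`‖Ũ₁ʲ(b) − 1‖ ≤ 130dLʲb`, every `j ≤ k`** — lit ✓`norm_tildIter_sub_one_le`'s conclusion WITHOUT its (1.141) window `hP`. [cite: Balaban1985Averaging, (97) p.32, (161)-(163) p.42] -/
theorem norm_tildIter_sub_one_le_of_skew {j : ℕ} (hj : j ≤ k) (z : LSite d) (κ : Fin d) :
    ‖((tildIter L U₀ (expCfg B) j z κ : 𝔸ˣ) : 𝔸) - 1‖ ≤ 130 * (d : ℝ) * ((L : ℝ) ^ j * b) := by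
  obtain ⟨-, hW, hv⟩ := comb_tower_mem_unitaryUnits hd hL hU₀ hBs hα hα3 hα4 h52 hb hB hsmall hc₃ hsm2 j hj
  exact norm_tildIter_sub_one_le_of_mem hd hL hU₀ hα hα3 hα4 h52 hb hB hsmall hc₃ hsm2 hj hW hv z κ

include hd hL hU₀ hBs hα hα3 hα4 h52 hb hB hsmall hc₃ hsm2 in
/-- **`‖U̿₁ʲ(b) − 1‖ ≤ 2Lʲb`, every `j ≤ k`** — lit ✓`norm_dbavgCovIter_sub_one_le`'s conclusion WITHOUT `hP`. [cite: Balaban1985Averaging, (161) p.42; Balaban1985RegularSpaces, (1.143) p.100] -/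
theorem norm_dbavgCovIter_sub_one_le_of_skew {j : ℕ} (hj : j ≤ k) (z : LSite d) (κ : Fin d) :
    ‖((dbavgCovIter L U₀ (expCfg B) j z κ : 𝔸ˣ) : 𝔸) - 1‖ ≤ 2 * ((L : ℝ) ^ j * b) := by
  obtain ⟨-, hW, -⟩ := comb_tower_mem_unitaryUnits hd hL hU₀ hBs hα hα3 hα4 h52 hb hB hsmall hc₃ hsm2 j hj
  exact norm_dbavgCovIter_sub_one_le_of_mem hd hL hU₀ hα hα3 hα4 h52 hb hB hsmall hc₃ hsm2 hj hW z κ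

include hd hL hU₀ hBs hα hα3 hα4 h52 hb hB hsmall hc₃ hsm2 in
/-- **THE ACCUMULATED FRAMES ARE BI-CONTRACTIVE**: `‖v_j(z)‖ ≤ 1` and `‖v_j(z)⁻¹‖ ≤ 1`, every `j ≤ k` — F1's `hv`∕`hv'` letters (✓`Prop7CombAccFrameStep.norm_vcov_succ_sub_one_le_of_bicontractive`).
[cite: Balaban1985Averaging, (97) p.32, (19) p.21] -/
theorem norm_vcov_le_one_of_skew {j : ℕ} (hj : j ≤ k) (z : LSite d) :
    ‖((vcov L U₀ (expCfg B) j z : 𝔸ˣ) : 𝔸)‖ ≤ 1 ∧ ‖(((vcov L U₀ (expCfg B) j z)⁻¹ : 𝔸ˣ) : 𝔸)‖ ≤ 1 :=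
  unitaryUnits_le_U1 ((comb_tower_mem_unitaryUnits hd hL hU₀ hBs hα hα3 hα4 h52 hb hB hsmall hc₃ hsm2 j hj).2.2 z)

include hd hL hU₀ hBs hα hα3 hα4 h52 hb hB hsmall hc₃ hsm2 in
/-- **THE ONE-STEP BLOCK FRAMES (82) OF THE DOUBLE-BAR TOWER ARE UNITARY**, every `j < k` (lit ✓`wframe_mem_unitaryUnits` ∘ ✓`twist_le_quarter`, fed by the tower's unitarity).
[cite: Balaban1985Averaging, (82) p.30, (22)-(23) p.21, (159)-(162) p.42] -/
theorem wframe_mem_unitaryUnits_of_skew {j : ℕ} (hj : j < k) (y : LSite d) :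
    wframe L (avgIter L U₀ j) (dbavgCovIter L U₀ (expCfg B) j) y ∈ unitaryUnits 𝔸 := by
  obtain ⟨-, hW, -⟩ := comb_tower_mem_unitaryUnits hd hL hU₀ hBs hα hα3 hα4 h52 hb hB hsmall hc₃ hsm2 j hj.le
  exact wframe_mem_unitaryUnits L (avgIter_mem_unitaryUnits hL hU₀ hα hα3 hα4 h52 j hj.le) hW y
    (fun r => twist_le_quarter hd hL hU₀ hα hα3 hα4 h52 hb hB hsmall hc₃ (level_windows hd hL hb hsm2).1 hj y r)

include hd hL hU₀ hBs hα hα3 hα4 h52 hb hB hsmall hc₃ hsm2 in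
/-- **THE SINGLE-BAR TREE RATIOS `(R_{0,y}Ũ₁ʲ)(Γ) = \overline{U₁U₀}ʲ(Γ)·Ū₀ʲ(Γ)⁻¹` ARE UNITARY AND WITHIN `(1 + 130dLʲb)^{|Γ|} − 1` OF `1`** for every word `Γ` and every `j ≤ k` (lit `tHol`; the
objects of F2's walk sums; §1's product-holonomy bound). [cite: Balaban1985Averaging, (58) p.27, (69) p.29, (161)-(163) p.42] -/
theorem tHol_tildIter_mem_and_norm_sub_one_le {j : ℕ} (hj : j ≤ k) (y : LSite d) (w : List (Letter d)) :
    tHol (avgIter L U₀ j) (tildIter L U₀ (expCfg B) j) y w ∈ unitaryUnits 𝔸 ∧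
      ‖((tHol (avgIter L U₀ j) (tildIter L U₀ (expCfg B) j) y w : 𝔸ˣ) : 𝔸) - 1‖ ≤ (1 + 130 * (d : ℝ) * ((L : ℝ) ^ j * b)) ^ w.length - 1 := by
  have hV₀ := avgIter_mem_unitaryUnits hL hU₀ hα hα3 hα4 h52 j hj
  have htu : ∀ x κ, tildIter L U₀ (expCfg B) j x κ ∈ unitaryUnits 𝔸 := fun x κ =>
    tildIter_mem_unitaryUnits hd hL hU₀ hBs hα hα3 hα4 h52 hb hB hsmall hc₃ hsm2 hj x κ
  refine ⟨B8Prop7AdmittedFamily.tHol_mem_unitaryUnits hV₀ htu y w, ?_⟩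
  have hV₁ : ∀ x κ, ‖((tildIter L U₀ (expCfg B) j x κ : 𝔸ˣ) : 𝔸) - 1‖ ≤ 130 * (d : ℝ) * ((L : ℝ) ^ j * b) ∧
      ‖(((tildIter L U₀ (expCfg B) j x κ)⁻¹ : 𝔸ˣ) : 𝔸) - 1‖ ≤ 130 * (d : ℝ) * ((L : ℝ) ^ j * b) := fun x κ =>
    ⟨norm_tildIter_sub_one_le_of_skew hd hL hU₀ hBs hα hα3 hα4 h52 hb hB hsmall hc₃ hsm2 hj x κ,
      (norm_inv_sub_one_le (unitaryUnits_le_U1 (htu x κ))).trans (norm_tildIter_sub_one_le_of_skew hd hL hU₀ hBs hα hα3 hα4 h52 hb hB hsmall hc₃ hsm2 hj x κ)⟩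
  have hU1 : ∀ x κ, avgIter L U₀ j x κ ∈ U1 𝔸 := fun x κ => unitaryUnits_le_U1 (hV₀ x κ)
  have h := norm_hol_mul_sub_hol_le hU1 (by positivity) hV₁ y w
  -- `tHol V₀ V₁ y w = (V₁V₀)(w)·V₀(w)⁻¹`, and `V₀(w)` is unitary: `‖XY⁻¹ − 1‖ = ‖(X − Y)Y⁻¹‖ ≤ ‖X − Y‖`
  have hH := unitaryUnits_le_U1 (hol_mem_of hV₀ y w)
  have e1 : ((tHol (avgIter L U₀ j) (tildIter L U₀ (expCfg B) j) y w : 𝔸ˣ) : 𝔸) - 1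
      = (((hol (tildIter L U₀ (expCfg B) j * avgIter L U₀ j) y w : 𝔸ˣ) : 𝔸) - ((hol (avgIter L U₀ j) y w : 𝔸ˣ) : 𝔸))
        * (((hol (avgIter L U₀ j) y w)⁻¹ : 𝔸ˣ) : 𝔸) := by
    rw [B7Eq92Concrete.tHol, Units.val_mul, sub_mul, Units.mul_inv]
  rw [e1]
  exact (norm_mul_le _ _).trans (by nlinarith [hH.2, norm_nonneg ((((hol (tildIter L U₀ (expCfg B) j * avgIter L U₀ j) y w : 𝔸ˣ) : 𝔸) - ((hol (avgIter L U₀ j) y w : 𝔸ˣ) : 𝔸)))])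

end Tower

/-! ## §2 The T³ member: the comb tower of the based pullbacks `W♯`, `(e^{A})♯` at a printed-regular background — `hMcomb`'s own objects -/

section Member

open Literature.MathematicalPhysics.QuantumFieldTheory.Balaban1983to89.T3ContinuumYM3Torus
open T3PrintedRegularMinimiser (RegPr)
open T3SectALandauChart (eta eta_pos bgUnits)
open B7Prop2SpecialUnitary (specialUnitaryUnits_le_unitaryUnits)
open B10Eq27TorusAxialLog (pull transl)
open Summit.QuantumFields.YangMills.Theorems.Prop7SPrint (basePt)
open Summit.QuantumFields.YangMills.Theorems.Prop7SPrintIn19 (pow_mul_eta)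
open Summit.QuantumFields.YangMills.Theorems.Prop7AxialReprPrint (pull_toUField_mem inAk_pull_of_regPr pdev_pull_lt)
open Summit.QuantumFields.YangMills.Theorems.Prop7SymAvgGLSmallOfRegPr (bgUnits_eq)
open Summit.QuantumFields.YangMills.Theorems.Prop7SymAvgTw (frameTw)
open Summit.QuantumFields.YangMills.Theorems.Prop7SymAvgTwFrameDiff (frameTw_eq_vcov pull_expUnit_eq_expCfg)

/-- The (β) door's exponent `A := I•D`, `D` Hermitian, IS bondwise skew-adjoint: `(I•D)ᴴ = conj(I)•Dᴴ = −I•D`. [cite: Balaban1985Variational, (19) p.281] -/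
theorem star_I_smul_eq_neg {m : Type*} [Fintype m] {D : Matrix m m ℂ} (hD : D.IsHermitian) : star (Complex.I • D) = -(Complex.I • D) := by
  rw [Matrix.star_eq_conjTranspose, Matrix.conjTranspose_smul, hD.eq, Complex.star_def, Complex.conj_I, neg_smul]

variable (F : T3Family) {n K : ℕ} (h : n ≤ K)

/-- ★★★ **THE COMB TOWER OF THE BASED PULLBACKS IS UNITARY-VALUED AT A PRINTED-REGULAR BACKGROUND, FOR EVERY BONDWISE-SKEW `A` WITH `‖A(b)‖ ≤ e·η`** — every level `l ≤ K − n`; the plain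
averages `\overline{(e^{A}W)♯}ˡ`, the double bars `U̿₁ˡ`, the frames `v_l` and the single bars `Ũ₁ˡ` of `hMcomb`'s own objects (`W♯ = pull (bgUnits W) x₀`, `(e^{A})♯ = pull (e^{A}) x₀`, `x₀ = basePt`)
lie in `U(2)`; under (WΣ) (✓`norm_frameTw_sub_one_le_of_regPr`'s `hα3 hα4 hsmall hc₃` VERBATIM) and `10⁶L²e ≤ 1`; NO (19)-gradient clause, NO (1.141).
[cite: Balaban1985Averaging, (42)-(43) pp.23-24, (89)-(92) p.31, (97) p.32; Balaban1985RegularSpaces, Prop. 7 (1.139)-(1.145) p.100; Balaban1985Variational, (2) p.278, (19) p.281] -/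
theorem comb_tower_mem_unitaryUnits_of_regPr {ε₀ e : ℝ} (hε₀ : 0 < ε₀) (he : 0 ≤ e)
    (hα3 : C0 (F.P K).d * (2 * ε₀) ≤ 1 / 3) (hα4 : 4 * (2 * ε₀) ≤ c2' (F.P K).d (F.P K).L)
    (hsmall : Real.exp (4 * (800 * (((F.P K).d : ℝ) + 1) ^ 2 * (((F.P K).d : ℝ) + 4)) * (2 * ε₀))
      * (1 + 8 * (131072 * (((F.P K).d : ℝ) + 1) ^ 2) * e) ≤ 2)
    (hc₃ : 2 * e ≤ c3 (F.P K).d (F.P K).L) (he6 : 10 ^ 6 * (F.L : ℝ) ^ 2 * e ≤ 1)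
    (W : GaugeField (F.P K) 0 (Matrix.specialUnitaryGroup (Fin 2) ℂ)) (hreg : RegPr F n K ε₀ W)
    (A : PBond (F.P K) 0 → Matrix (Fin 2) (Fin 2) ℂ) (hA : ∀ b, ‖A b‖ ≤ e * eta F n K) (hAs : ∀ b, star (A b) = -A b) :
    ∀ l ≤ K - n,
      (∀ (z : LSite (F.P K).d) (κ : Fin (F.P K).d),
          avgIter (F.P K).L (pull (fun b => expUnit (A b)) (basePt F n K) * pull (bgUnits F K W) (basePt F n K)) l z κ ∈ unitaryUnits (Matrix (Fin 2) (Fin 2) ℂ)) ∧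
      (∀ (z : LSite (F.P K).d) (κ : Fin (F.P K).d),
          dbavgCovIter (F.P K).L (pull (bgUnits F K W) (basePt F n K)) (pull (fun b => expUnit (A b)) (basePt F n K)) l z κ ∈ unitaryUnits (Matrix (Fin 2) (Fin 2) ℂ)) ∧
      (∀ z : LSite (F.P K).d, vcov (F.P K).L (pull (bgUnits F K W) (basePt F n K)) (pull (fun b => expUnit (A b)) (basePt F n K)) l z ∈ unitaryUnits (Matrix (Fin 2) (Fin 2) ℂ)) ∧
      (∀ (z : LSite (F.P K).d) (κ : Fin (F.P K).d),
          tildIter (F.P K).L (pull (bgUnits F K W) (basePt F n K)) (pull (fun b => expUnit (A b)) (basePt F n K)) l z κ ∈ unitaryUnits (Matrix (Fin 2) (Fin 2) ℂ)) ∧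
      ∀ (z : LSite (F.P K).d) (κ : Fin (F.P K).d),
          ‖((tildIter (F.P K).L (pull (bgUnits F K W) (basePt F n K)) (pull (fun b => expUnit (A b)) (basePt F n K)) l z κ : (Matrix (Fin 2) (Fin 2) ℂ)ˣ) : Matrix (Fin 2) (Fin 2) ℂ) - 1‖
            ≤ 390 * ((F.L : ℝ) ^ l * (e * eta F n K)) := by
  letI : CStarAlgebra (Matrix (Fin 2) (Fin 2) ℂ) := B10Eq29TubeLine.cstarAlgebraMatrix 2
  have hL2 : 2 ≤ (F.P K).L := (F.P K).hL.2
  have hd3 : (F.P K).d = 3 := T3Family.P_d F K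
  have hd : 1 ≤ (F.P K).d := by omega
  have hd3r : ((F.P K).d : ℝ) = 3 := by exact_mod_cast hd3
  have hLL : ((F.P K).L : ℝ) = F.L := rfl
  have hη : 0 < eta F n K := eta_pos F n K
  have hLη : ((F.P K).L : ℝ) ^ (K - n) * eta F n K = 1 := pow_mul_eta F n K
  have hLb : ((F.P K).L : ℝ) ^ (K - n) * (e * eta F n K) = e := by rw [mul_left_comm, hLη, mul_one]
  -- lit's tower data read from `RegPr` on the based pullbacks
  have hU₀ : ∀ (z : LSite (F.P K).d) (κ : Fin (F.P K).d), pull (bgUnits F K W) (basePt F n K) z κ ∈ unitaryUnits (Matrix (Fin 2) (Fin 2) ℂ) := fun z κ =>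
    specialUnitaryUnits_le_unitaryUnits (by rw [bgUnits_eq]; exact pull_toUField_mem W _ z κ)
  have h52 : pdev (pull (bgUnits F K W) (basePt F n K)) < 2 * ε₀ * ((((F.P K).L : ℝ) ^ (K - n))⁻¹) ^ 2 := by
    rw [bgUnits_eq]; exact pdev_pull_lt (P := F.P K) hε₀ (inAk_pull_of_regPr F (n := n) (K := K) hε₀.le hreg) (basePt F n K)
  have hα : 0 < 2 * ε₀ := by positivity
  have hb : 0 ≤ e * eta F n K := by positivity
  set B : LSite (F.P K).d → Fin (F.P K).d → Matrix (Fin 2) (Fin 2) ℂ := fun z κ => A ⟨transl (basePt F n K) z, κ⟩ with hBdef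
  have hB : ∀ (z : LSite (F.P K).d) (κ : Fin (F.P K).d), ‖B z κ‖ ≤ e * eta F n K := fun z κ => hA _
  have hBs : ∀ (z : LSite (F.P K).d) (κ : Fin (F.P K).d), star (B z κ) = -B z κ := fun z κ => hAs _
  have hsmall' : Real.exp (4 * (800 * (((F.P K).d : ℝ) + 1) ^ 2 * (((F.P K).d : ℝ) + 4)) * (2 * ε₀))
      * (1 + 8 * (131072 * (((F.P K).d : ℝ) + 1) ^ 2) * (((F.P K).L : ℝ) ^ (K - n) * (e * eta F n K))) ≤ 2 := by rw [hLb]; exact hsmall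
  have hc₃' : 2 * (((F.P K).L : ℝ) ^ (K - n) * (e * eta F n K)) ≤ c3 (F.P K).d (F.P K).L := by rw [hLb]; exact hc₃
  have hsm2 : 4096 * ((F.P K).d : ℝ) * (((F.P K).d : ℝ) + 1) * (((F.P K).L : ℝ) ^ (K - n) * (e * eta F n K)) ≤ 1 := by
    rw [hLb, hd3r]
    have hL2r : (2 : ℝ) ≤ F.L := by exact_mod_cast F.hL.2
    nlinarith [mul_nonneg (mul_nonneg (by norm_num : (0:ℝ) ≤ 10 ^ 6) (sq_nonneg (F.L : ℝ))) he]
  have hpull : pull (fun b => expUnit (A b)) (basePt F n K) = expCfg B := pull_expUnit_eq_expCfg F A _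
  intro l hl
  rw [hpull]
  obtain ⟨h1, h2, h3⟩ := comb_tower_mem_unitaryUnits hd hL2 hU₀ hBs hα hα3 hα4 h52 hb hB hsmall' hc₃' hsm2 l hl
  refine ⟨h1, h2, h3, fun z κ => tildIter_mem_unitaryUnits hd hL2 hU₀ hBs hα hα3 hα4 h52 hb hB hsmall' hc₃' hsm2 hl z κ, fun z κ => ?_⟩
  have h4 := norm_tildIter_sub_one_le_of_skew hd hL2 hU₀ hBs hα hα3 hα4 h52 hb hB hsmall' hc₃' hsm2 hl z κ
  rw [hd3r, hLL] at h4
  linarith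

/-- ★★ **THE ACCUMULATED COMB FRAME `w_A(y) = frameTw W A y` IS UNITARY AND BI-CONTRACTIVE** at a printed-regular background, for every bondwise-skew `A` with `‖A(b)‖ ≤ e·η` (✓`frameTw_eq_vcov`
+ §2 at level `K − n`) — px13 g6's displayed `hcU : ∀ y, ‖↑(frameTw … y)⁻¹‖ ≤ 1` (R0-DOOR §2) and the unitarity F3″-COMB's F2∕F3 need at the top, hP-free.
[cite: Balaban1985Averaging, (82) p.30, (97)-(99) p.32; Balaban1985RegularSpaces, Prop. 7 (1.139) p.100; Balaban1985Variational, (19) p.281] -/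
theorem frameTw_mem_unitaryUnits_of_regPr {ε₀ e : ℝ} (hε₀ : 0 < ε₀) (he : 0 ≤ e)
    (hα3 : C0 (F.P K).d * (2 * ε₀) ≤ 1 / 3) (hα4 : 4 * (2 * ε₀) ≤ c2' (F.P K).d (F.P K).L)
    (hsmall : Real.exp (4 * (800 * (((F.P K).d : ℝ) + 1) ^ 2 * (((F.P K).d : ℝ) + 4)) * (2 * ε₀))
      * (1 + 8 * (131072 * (((F.P K).d : ℝ) + 1) ^ 2) * e) ≤ 2)
    (hc₃ : 2 * e ≤ c3 (F.P K).d (F.P K).L) (he6 : 10 ^ 6 * (F.L : ℝ) ^ 2 * e ≤ 1)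
    (W : GaugeField (F.P K) 0 (Matrix.specialUnitaryGroup (Fin 2) ℂ)) (hreg : RegPr F n K ε₀ W)
    (A : PBond (F.P K) 0 → Matrix (Fin 2) (Fin 2) ℂ) (hA : ∀ b, ‖A b‖ ≤ e * eta F n K) (hAs : ∀ b, star (A b) = -A b) (y : Site (F.P n) 0) :
    frameTw F n K h W A y ∈ unitaryUnits (Matrix (Fin 2) (Fin 2) ℂ) ∧
      ‖((frameTw F n K h W A y : (Matrix (Fin 2) (Fin 2) ℂ)ˣ) : Matrix (Fin 2) (Fin 2) ℂ)‖ ≤ 1 ∧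
      ‖(((frameTw F n K h W A y)⁻¹ : (Matrix (Fin 2) (Fin 2) ℂ)ˣ) : Matrix (Fin 2) (Fin 2) ℂ)‖ ≤ 1 := by
  letI : CStarAlgebra (Matrix (Fin 2) (Fin 2) ℂ) := B10Eq29TubeLine.cstarAlgebraMatrix 2
  obtain ⟨-, -, h3, -, -⟩ := comb_tower_mem_unitaryUnits_of_regPr F hε₀ he hα3 hα4 hsmall hc₃ he6 W hreg A hA hAs (K - n) le_rfl
  have hmem : frameTw F n K h W A y ∈ unitaryUnits (Matrix (Fin 2) (Fin 2) ℂ) := by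
    rw [frameTw_eq_vcov, ← pull_expUnit_eq_expCfg]
    exact h3 _
  exact ⟨hmem, unitaryUnits_le_U1 hmem⟩

end Member

end Summit.QuantumFields.YangMills.Theorems.Prop7CombTowerUnitaryOfSkew

end
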